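import Literature.MathematicalPhysics.KineticTheory.TruncatedPicardFunctionals
import Literature.MathematicalPhysics.KineticTheory.DiPernaLionsEquicontinuity
import HarnessLib

/-!
# The truncated collision functionals: Lipschitz bounds, continuity, identification

Topic: MathematicalPhysics / KineticTheory. Third part of the slice theory of the truncated
collision functionals (`TruncatedPicardFunctionals`, infrastructure for CIP 1994 §5.3
Lemma 5.3.6):

* **CIP (3.20), the Lipschitz estimate** in weighted sup norms: for two nonnegative Schwartz-type
  slices `g, g'` with `(1 + ‖y‖)ᴷ |g - g'| ≤ D` (`K ≥ d + 1`),
  `|mass g - mass g'| ≤ J_d D`, `|Λ_g - Λ_{g'}| ≤ c D` (`TruncPicard.abs_absorption_sub_le`) and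
  `(1 + ‖z‖)ᴷ |Γ_g(z) - Γ_{g'}(z)| ≤ c D` (`TruncPicard.weight_mul_abs_source_sub_le`), with `c`
  depending on sup bounds of `g, g'` only — the estimate behind the convergence of the iteration;
* **continuity in a parameter** (`TruncPicard.continuousWithinAt_source` etc.): for a family of
  slices continuous in the parameter pointwise, with uniform bounds, the functionals are
  continuous in the parameter (dominated convergence);
* **identification** (`TruncPicard.truncatedCollisionOp_eq`): for a nonnegative Schwartz-type slice
  `g` and the truncated kernels of the scheme,
  `truncatedCollisionOp δ B (g(x, ·)) v = Γ_g(x, v) - Λ_g(x, v) g(x, v)` — the gain/loss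
  splitting of `collisionOpWith` (`collisionOpWith_eq_gainWith_sub_lossWith_holds`), Fubini, and
  the substitution `v_* = v - u`.

Everything is proved; theorems only.

## References

* C. Cercignani, R. Illner, M. Pulvirenti, *The Mathematical Theory of Dilute Gases*, Springer
  (1994), §5.3 (3.16)–(3.20), pp. 145–146.
-/

open MeasureTheory Metric Real Set Filter Function
open scoped InnerProductSpace ENNReal ContDiff Topology

noncomputable section

namespace Literature.MathematicalPhysics.KineticTheory

open Literature.Analysis.Calculus Literature.Analysis.FluidPDE

variable {E : Type*} [NormedAddCommGroup E] [InnerProductSpace ℝ E] [FiniteDimensional ℝ E]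
  [MeasurableSpace E] [BorelSpace E]

namespace TruncPicard

variable {B : E × E → sphere (0 : E) 1 → ℝ} {M R : ℝ} {g g' : E × E → ℝ} {C C' : ℕ → ℕ → ℝ} {δ : ℝ}

/-! ## Lipschitz bounds (CIP (3.20)) -/

omit [FiniteDimensional ℝ E] [MeasurableSpace E] [BorelSpace E] in
/-- Decay of a weighted difference in the velocity variable. [folklore] -/
theorem abs_sub_le_weight_inv {D : ℝ}
    (hD : ∀ y : E × E, (1 + ‖y‖) ^ (Module.finrank ℝ E + 1) * |g y - g' y| ≤ D) (x w : E) :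
    |g (x, w) - g' (x, w)| ≤ D * (1 + ‖w‖) ^ (-((Module.finrank ℝ E : ℝ) + 1)) := by
  have hD0 : 0 ≤ D := le_trans (by positivity) (hD 0)
  have hw : 0 < 1 + ‖w‖ := by positivity
  have hle : (1 + ‖w‖) ^ (Module.finrank ℝ E + 1) ≤ (1 + ‖((x, w) : E × E)‖) ^ (Module.finrank ℝ E + 1) :=
    pow_le_pow_left₀ hw.le (by simp [Prod.norm_def]) _
  have h1 : (1 + ‖w‖) ^ (Module.finrank ℝ E + 1) * |g (x, w) - g' (x, w)| ≤ D :=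
    le_trans (mul_le_mul_of_nonneg_right hle (abs_nonneg _)) (hD (x, w))
  have hrpow : (1 + ‖w‖) ^ (-((Module.finrank ℝ E : ℝ) + 1)) = ((1 + ‖w‖) ^ (Module.finrank ℝ E + 1))⁻¹ := by
    rw [Real.rpow_neg hw.le, ← Real.rpow_natCast]
    push_cast
    ring_nf
  rw [hrpow, ← div_eq_mul_inv, le_div_iff₀ (by positivity), mul_comm]
  exact h1

/-- **Lipschitz bound for the local mass**: `|mass g (z) - mass g' (z)| ≤ J_d D` when
`(1 + ‖y‖)^{d+1} |g(y) - g'(y)| ≤ D`. [cite: CIPDiluteGases1994, §5.3 (3.20)] -/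
theorem abs_mass_sub_le (hg : ContDiff ℝ ∞ g)
    (hC : ∀ (n k : ℕ) (z : E × E), (1 + ‖z‖) ^ k * ‖iteratedFDeriv ℝ n g z‖ ≤ C n k)
    (hg' : ContDiff ℝ ∞ g')
    (hC' : ∀ (n k : ℕ) (z : E × E), (1 + ‖z‖) ^ k * ‖iteratedFDeriv ℝ n g' z‖ ≤ C' n k) {D : ℝ}
    (hD : ∀ y : E × E, (1 + ‖y‖) ^ (Module.finrank ℝ E + 1) * |g y - g' y| ≤ D) (z : E × E) :
    |mass g z - mass g' z| ≤ (∫ w : E, (1 + ‖w‖) ^ (-((Module.finrank ℝ E : ℝ) + 1))) * D := by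
  rw [mass, mass, ← integral_sub (integrable_mass_integrand hg hC z.1) (integrable_mass_integrand hg' hC' z.1),
    mul_comm, ← integral_const_mul]
  refine (abs_integral_le_integral_abs).trans (integral_mono_of_nonneg (Eventually.of_forall fun w => abs_nonneg _)
    (integrable_weight_inv.const_mul D) (Eventually.of_forall fun w => ?_))
  exact abs_sub_le_weight_inv hD z.1 w

/-- **Lipschitz bound for the normalising factor**: `|N_g - N_{g'}| ≤ δ J_d D`. [folklore] -/
theorem abs_normFactor_sub_le (hδ : 0 ≤ δ) (hg : ContDiff ℝ ∞ g) (hg0 : ∀ z, 0 ≤ g z)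
    (hC : ∀ (n k : ℕ) (z : E × E), (1 + ‖z‖) ^ k * ‖iteratedFDeriv ℝ n g z‖ ≤ C n k)
    (hg' : ContDiff ℝ ∞ g') (hg'0 : ∀ z, 0 ≤ g' z)
    (hC' : ∀ (n k : ℕ) (z : E × E), (1 + ‖z‖) ^ k * ‖iteratedFDeriv ℝ n g' z‖ ≤ C' n k) {D : ℝ}
    (hD : ∀ y : E × E, (1 + ‖y‖) ^ (Module.finrank ℝ E + 1) * |g y - g' y| ≤ D) (z : E × E) :
    |normFactor δ g z - normFactor δ g' z| ≤ δ * ((∫ w : E, (1 + ‖w‖) ^ (-((Module.finrank ℝ E : ℝ) + 1))) * D) := by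
  have ha := mass_nonneg hg0 z
  have hb := mass_nonneg hg'0 z
  have hpa : 0 < 1 + δ * mass g z := by nlinarith
  have hpb : 0 < 1 + δ * mass g' z := by nlinarith
  rw [normFactor, normFactor, inv_sub_inv hpa.ne' hpb.ne', abs_div, abs_mul, abs_of_pos hpa, abs_of_pos hpb]
  have hnum : |1 + δ * mass g' z - (1 + δ * mass g z)| = δ * |mass g z - mass g' z| := by
    rw [show 1 + δ * mass g' z - (1 + δ * mass g z) = -(δ * (mass g z - mass g' z)) by ring, abs_neg, abs_mul,
      abs_of_nonneg hδ]
  rw [hnum, div_le_iff₀ (mul_pos hpa hpb)]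
  have h1 : (1:ℝ) ≤ (1 + δ * mass g z) * (1 + δ * mass g' z) := by nlinarith [mul_nonneg hδ ha, mul_nonneg hδ hb]
  have h2 := abs_mass_sub_le hg hC hg' hC' hD z
  calc δ * |mass g z - mass g' z| ≤ δ * ((∫ w : E, (1 + ‖w‖) ^ (-((Module.finrank ℝ E : ℝ) + 1))) * D) :=
        mul_le_mul_of_nonneg_left h2 hδ
    _ = δ * ((∫ w : E, (1 + ‖w‖) ^ (-((Module.finrank ℝ E : ℝ) + 1))) * D) * 1 := (mul_one _).symm
    _ ≤ _ := mul_le_mul_of_nonneg_left h1 (mul_nonneg hδ (le_trans (abs_nonneg _) h2))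

/-- **Lipschitz bound for the loss frequency**: `|loss g - loss g'| ≤ ‖B‖₁ D₀` when `|g - g'| ≤ D₀`.
[folklore] -/
theorem abs_loss_sub_le (h : KernelHyp B M R) (hg : ContDiff ℝ ∞ g)
    (hC : ∀ (n k : ℕ) (z : E × E), (1 + ‖z‖) ^ k * ‖iteratedFDeriv ℝ n g z‖ ≤ C n k)
    (hg' : ContDiff ℝ ∞ g')
    (hC' : ∀ (n k : ℕ) (z : E × E), (1 + ‖z‖) ^ k * ‖iteratedFDeriv ℝ n g' z‖ ≤ C' n k) {D₀ : ℝ}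
    (hD₀ : ∀ y, |g y - g' y| ≤ D₀) (z : E × E) : |loss B g z - loss B g' z| ≤ kernelMass B * D₀ := by
  have hi : ∀ {k : E × E → ℝ} {Ck : ℕ → ℕ → ℝ}, ContDiff ℝ ∞ k →
      (∀ (n m : ℕ) (z : E × E), (1 + ‖z‖) ^ m * ‖iteratedFDeriv ℝ n k z‖ ≤ Ck n m) →
      Integrable (fun q : E × sphere (0 : E) 1 => B (q.1, 0) q.2 * k (z + shiftLoss q)) (kernelMeasure E) :=
    fun hk hCk => h.integrable_mul ((hk.continuous.comp (continuous_const.add continuous_shiftLoss)).aestronglyMeasurable)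
      (fun q => by rw [Real.norm_eq_abs]; exact abs_le_of_bounds hCk _)
  rw [loss, loss, ← integral_sub (hi hg hC) (hi hg' hC')]
  have e : (fun q : E × sphere (0 : E) 1 => B (q.1, 0) q.2 * g (z + shiftLoss q) - B (q.1, 0) q.2 * g' (z + shiftLoss q)) =
      fun q => B (q.1, 0) q.2 * (g (z + shiftLoss q) - g' (z + shiftLoss q)) := funext fun q => by ring
  rw [e]
  have := h.norm_integral_mul_le (φ := fun q => g (z + shiftLoss q) - g' (z + shiftLoss q)) (K := D₀)
    fun q => by rw [Real.norm_eq_abs]; exact hD₀ _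
  rwa [Real.norm_eq_abs] at this

/-- **Weighted Lipschitz bound for the gain term**: with `Mb` bounding `|g|, |g'|` and
`(1 + ‖y‖)ᴷ |g|, (1 + ‖y‖)ᴷ |g'|`, and `(1 + ‖y‖)ᴷ |g - g'| ≤ D`:
`(1 + ‖z‖)ᴷ |gain g (z) - gain g' (z)| ≤ ‖B‖₁ 2ᴷ (4 Mb) D`. [cite: CIPDiluteGases1994, §5.3 (3.20)] -/
theorem weight_mul_abs_gain_sub_le (h : KernelHyp B M R) (hg : ContDiff ℝ ∞ g)
    (hC : ∀ (n k : ℕ) (z : E × E), (1 + ‖z‖) ^ k * ‖iteratedFDeriv ℝ n g z‖ ≤ C n k)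
    (hg' : ContDiff ℝ ∞ g')
    (hC' : ∀ (n k : ℕ) (z : E × E), (1 + ‖z‖) ^ k * ‖iteratedFDeriv ℝ n g' z‖ ≤ C' n k)
    {K : ℕ} {Mb D : ℝ} (hM : ∀ y, |g y| ≤ Mb) (hM' : ∀ y, |g' y| ≤ Mb)
    (hMK : ∀ y : E × E, (1 + ‖y‖) ^ K * |g y| ≤ Mb) (hMK' : ∀ y : E × E, (1 + ‖y‖) ^ K * |g' y| ≤ Mb)
    (hD : ∀ y : E × E, (1 + ‖y‖) ^ K * |g y - g' y| ≤ D) (z : E × E) :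
    (1 + ‖z‖) ^ K * |gain B g z - gain B g' z| ≤ kernelMass B * (2 ^ K * (4 * Mb) * D) := by
  have hMb0 : 0 ≤ Mb := (abs_nonneg _).trans (hM 0)
  have hD0 : 0 ≤ D := le_trans (by positivity) (hD 0)
  have hw0 : 0 < (1 + ‖z‖) ^ K := by positivity
  have hDu : ∀ y, |g y - g' y| ≤ D := fun y => by
    have := hD y
    have h1 : (1:ℝ) ≤ (1 + ‖y‖) ^ K := one_le_pow₀ (le_add_of_nonneg_right (norm_nonneg _))
    nlinarith [abs_nonneg (g y - g' y)]
  have hi : ∀ {k : E × E → ℝ} {Ck : ℕ → ℕ → ℝ}, ContDiff ℝ ∞ k →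
      (∀ (n m : ℕ) (z : E × E), (1 + ‖z‖) ^ m * ‖iteratedFDeriv ℝ n k z‖ ≤ Ck n m) →
      Integrable (fun q : E × sphere (0 : E) 1 => B (q.1, 0) q.2 * (k (z + shift₁ q) * k (z + shift₂ q)))
        (kernelMeasure E) :=
    fun {k} {Ck} hk hCk => h.integrable_mul (((hk.continuous.comp (continuous_const.add continuous_shift₁)).mul
      (hk.continuous.comp (continuous_const.add continuous_shift₂))).aestronglyMeasurable)
      (K := Ck 0 0 * Ck 0 0) fun q => by
        rw [Real.norm_eq_abs, abs_mul]
        exact mul_le_mul (abs_le_of_bounds hCk _) (abs_le_of_bounds hCk _) (abs_nonneg _) (bound_nonneg hCk 0 0)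
  rw [gain, gain, ← integral_sub (hi hg hC) (hi hg' hC')]
  have e : (fun q : E × sphere (0 : E) 1 => B (q.1, 0) q.2 * (g (z + shift₁ q) * g (z + shift₂ q)) -
      B (q.1, 0) q.2 * (g' (z + shift₁ q) * g' (z + shift₂ q))) =
      fun q => B (q.1, 0) q.2 * (g (z + shift₁ q) * g (z + shift₂ q) - g' (z + shift₁ q) * g' (z + shift₂ q)) :=
    funext fun q => by ring
  rw [e]
  -- the pointwise weighted bound
  have hpt : ∀ q : E × sphere (0 : E) 1, (1 + ‖z‖) ^ K *
      |g (z + shift₁ q) * g (z + shift₂ q) - g' (z + shift₁ q) * g' (z + shift₂ q)| ≤ 2 ^ K * (4 * Mb) * D := by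
    intro q
    set a := z + shift₁ q
    set b := z + shift₂ q
    have hsplit : g a * g b - g' a * g' b = (g a - g' a) * g b + g' a * (g b - g' b) := by ring
    rw [hsplit]
    have hw := weight_le_add_shift z q K
    have hA : (1 + ‖a‖) ^ K * |(g a - g' a) * g b + g' a * (g b - g' b)| ≤ 2 * Mb * D := by
      calc (1 + ‖a‖) ^ K * |(g a - g' a) * g b + g' a * (g b - g' b)|
          ≤ (1 + ‖a‖) ^ K * (|g a - g' a| * |g b| + |g' a| * |g b - g' b|) := by
            refine mul_le_mul_of_nonneg_left ((abs_add_le _ _).trans (le_of_eq ?_)) (by positivity)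
            rw [abs_mul, abs_mul]
        _ = ((1 + ‖a‖) ^ K * |g a - g' a|) * |g b| + ((1 + ‖a‖) ^ K * |g' a|) * |g b - g' b| := by ring
        _ ≤ D * Mb + Mb * D := add_le_add (mul_le_mul (hD a) (hM b) (abs_nonneg _) hD0)
            (mul_le_mul (hMK' a) (hDu b) (abs_nonneg _) hMb0)
        _ = 2 * Mb * D := by ring
    have hB' : (1 + ‖b‖) ^ K * |(g a - g' a) * g b + g' a * (g b - g' b)| ≤ 2 * Mb * D := by
      calc (1 + ‖b‖) ^ K * |(g a - g' a) * g b + g' a * (g b - g' b)|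
          ≤ (1 + ‖b‖) ^ K * (|g a - g' a| * |g b| + |g' a| * |g b - g' b|) := by
            refine mul_le_mul_of_nonneg_left ((abs_add_le _ _).trans (le_of_eq ?_)) (by positivity)
            rw [abs_mul, abs_mul]
        _ = |g a - g' a| * ((1 + ‖b‖) ^ K * |g b|) + |g' a| * ((1 + ‖b‖) ^ K * |g b - g' b|) := by ring
        _ ≤ D * Mb + Mb * D := add_le_add (mul_le_mul (hDu a) (hMK b) (by positivity) hD0)
            (mul_le_mul (hM' a) (hD b) (by positivity) hMb0)
        _ = 2 * Mb * D := by ring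
    have h0 : 0 ≤ |(g a - g' a) * g b + g' a * (g b - g' b)| := abs_nonneg _
    calc (1 + ‖z‖) ^ K * |(g a - g' a) * g b + g' a * (g b - g' b)|
        ≤ 2 ^ K * ((1 + ‖a‖) ^ K + (1 + ‖b‖) ^ K) * |(g a - g' a) * g b + g' a * (g b - g' b)| :=
          mul_le_mul_of_nonneg_right hw h0
      _ = 2 ^ K * ((1 + ‖a‖) ^ K * |(g a - g' a) * g b + g' a * (g b - g' b)| +
          (1 + ‖b‖) ^ K * |(g a - g' a) * g b + g' a * (g b - g' b)|) := by ring
      _ ≤ 2 ^ K * (2 * Mb * D + 2 * Mb * D) := by gcongr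
      _ = 2 ^ K * (4 * Mb) * D := by ring
  have hbound : ∀ q : E × sphere (0 : E) 1,
      ‖g (z + shift₁ q) * g (z + shift₂ q) - g' (z + shift₁ q) * g' (z + shift₂ q)‖ ≤
        2 ^ K * (4 * Mb) * D / (1 + ‖z‖) ^ K := fun q => by
    rw [Real.norm_eq_abs, le_div_iff₀ hw0, mul_comm]; exact hpt q
  have hmain := h.norm_integral_mul_le hbound
  rw [Real.norm_eq_abs] at hmain
  calc (1 + ‖z‖) ^ K * |∫ q, B (q.1, 0) q.2 * (g (z + shift₁ q) * g (z + shift₂ q) -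
          g' (z + shift₁ q) * g' (z + shift₂ q)) ∂(kernelMeasure E)|
      ≤ (1 + ‖z‖) ^ K * (kernelMass B * (2 ^ K * (4 * Mb) * D / (1 + ‖z‖) ^ K)) :=
        mul_le_mul_of_nonneg_left hmain hw0.le
    _ = kernelMass B * (2 ^ K * (4 * Mb) * D) := by field_simp

/-- **Weighted Lipschitz bound for the source (CIP (3.20))**: under the hypotheses of
`weight_mul_abs_gain_sub_le` with `K ≥ d + 1` and nonnegative slices,
`(1 + ‖z‖)ᴷ |Γ_g(z) - Γ_{g'}(z)| ≤ (‖B‖₁ 2ᴷ 4 Mb + δ J_d ‖B‖₁ 2^{K+1} Mb²) D`. [cite: CIPDiluteGases1994, §5.3 (3.20)] -/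
theorem weight_mul_abs_source_sub_le (h : KernelHyp B M R) (hδ : 0 ≤ δ) (hg : ContDiff ℝ ∞ g)
    (hg0 : ∀ z, 0 ≤ g z)
    (hC : ∀ (n k : ℕ) (z : E × E), (1 + ‖z‖) ^ k * ‖iteratedFDeriv ℝ n g z‖ ≤ C n k)
    (hg' : ContDiff ℝ ∞ g') (hg'0 : ∀ z, 0 ≤ g' z)
    (hC' : ∀ (n k : ℕ) (z : E × E), (1 + ‖z‖) ^ k * ‖iteratedFDeriv ℝ n g' z‖ ≤ C' n k)
    {K : ℕ} (hK : Module.finrank ℝ E + 1 ≤ K) {Mb D : ℝ} (hM : ∀ y, |g y| ≤ Mb) (hM' : ∀ y, |g' y| ≤ Mb)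
    (hMK : ∀ y : E × E, (1 + ‖y‖) ^ K * |g y| ≤ Mb) (hMK' : ∀ y : E × E, (1 + ‖y‖) ^ K * |g' y| ≤ Mb)
    (hD : ∀ y : E × E, (1 + ‖y‖) ^ K * |g y - g' y| ≤ D) (z : E × E) :
    (1 + ‖z‖) ^ K * |source δ B g z - source δ B g' z| ≤
      (kernelMass B * (2 ^ K * (4 * Mb)) +
        δ * (∫ w : E, (1 + ‖w‖) ^ (-((Module.finrank ℝ E : ℝ) + 1))) * (kernelMass B * (2 ^ (K + 1) * Mb * Mb))) * D := by
  have hMb0 : 0 ≤ Mb := (abs_nonneg _).trans (hM 0)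
  have hD0 : 0 ≤ D := le_trans (by positivity) (hD 0)
  have hw0 : 0 < (1 + ‖z‖) ^ K := by positivity
  have hJ0 : 0 ≤ ∫ w : E, (1 + ‖w‖) ^ (-((Module.finrank ℝ E : ℝ) + 1)) :=
    integral_nonneg fun w => Real.rpow_nonneg (by positivity) _
  obtain ⟨hNp, hNle⟩ := normFactor_pos_le_one hδ hg0 z
  have hD' : ∀ y : E × E, (1 + ‖y‖) ^ (Module.finrank ℝ E + 1) * |g y - g' y| ≤ D := fun y =>
    le_trans (mul_le_mul_of_nonneg_right (pow_le_pow_right₀ (le_add_of_nonneg_right (norm_nonneg _)) hK)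
      (abs_nonneg _)) (hD y)
  have hN := abs_normFactor_sub_le hδ hg hg0 hC hg' hg'0 hC' hD' z
  have hGa := weight_mul_abs_gain_sub_le h hg hC hg' hC' hM hM' hMK hMK' hD z
  have hGa' : (1 + ‖z‖) ^ K * |gain B g' z| ≤ kernelMass B * (2 ^ (K + 1) * Mb * Mb) :=
    weight_mul_abs_gain_le h hMK' hM' z
  have hsplit : source δ B g z - source δ B g' z =
      normFactor δ g z * (gain B g z - gain B g' z) + (normFactor δ g z - normFactor δ g' z) * gain B g' z := by
    simp only [source]; ring
  rw [hsplit]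
  calc (1 + ‖z‖) ^ K * |normFactor δ g z * (gain B g z - gain B g' z) +
        (normFactor δ g z - normFactor δ g' z) * gain B g' z|
      ≤ (1 + ‖z‖) ^ K * (1 * |gain B g z - gain B g' z| +
          |normFactor δ g z - normFactor δ g' z| * |gain B g' z|) := by
        refine mul_le_mul_of_nonneg_left ((abs_add_le _ _).trans (add_le_add ?_ (le_of_eq (abs_mul _ _)))) hw0.le
        rw [abs_mul, abs_of_pos hNp]
        exact mul_le_mul_of_nonneg_right hNle (abs_nonneg _)
    _ = (1 + ‖z‖) ^ K * |gain B g z - gain B g' z| +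
          |normFactor δ g z - normFactor δ g' z| * ((1 + ‖z‖) ^ K * |gain B g' z|) := by ring
    _ ≤ kernelMass B * (2 ^ K * (4 * Mb) * D) +
          δ * ((∫ w : E, (1 + ‖w‖) ^ (-((Module.finrank ℝ E : ℝ) + 1))) * D) * (kernelMass B * (2 ^ (K + 1) * Mb * Mb)) :=
        add_le_add hGa (mul_le_mul hN hGa' (by positivity) (by positivity))
    _ = _ := by ring

/-- **Lipschitz bound for the absorption**: `|Λ_g(z) - Λ_{g'}(z)| ≤ (‖B‖₁ + δ J_d ‖B‖₁ Mb) D`. [cite: CIPDiluteGases1994, §5.3 (3.20)] -/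
theorem abs_absorption_sub_le (h : KernelHyp B M R) (hδ : 0 ≤ δ) (hg : ContDiff ℝ ∞ g) (hg0 : ∀ z, 0 ≤ g z)
    (hC : ∀ (n k : ℕ) (z : E × E), (1 + ‖z‖) ^ k * ‖iteratedFDeriv ℝ n g z‖ ≤ C n k)
    (hg' : ContDiff ℝ ∞ g') (hg'0 : ∀ z, 0 ≤ g' z)
    (hC' : ∀ (n k : ℕ) (z : E × E), (1 + ‖z‖) ^ k * ‖iteratedFDeriv ℝ n g' z‖ ≤ C' n k)
    {K : ℕ} (hK : Module.finrank ℝ E + 1 ≤ K) {Mb D : ℝ} (hM' : ∀ y, |g' y| ≤ Mb)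
    (hD : ∀ y : E × E, (1 + ‖y‖) ^ K * |g y - g' y| ≤ D) (z : E × E) :
    |absorption δ B g z - absorption δ B g' z| ≤
      (kernelMass B + δ * (∫ w : E, (1 + ‖w‖) ^ (-((Module.finrank ℝ E : ℝ) + 1))) * (kernelMass B * Mb)) * D := by
  have hMb0 : 0 ≤ Mb := (abs_nonneg _).trans (hM' 0)
  have hD0 : 0 ≤ D := le_trans (by positivity) (hD 0)
  obtain ⟨hNp, hNle⟩ := normFactor_pos_le_one hδ hg0 z
  have hDu : ∀ y, |g y - g' y| ≤ D := fun y => by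
    have := hD y
    have h1 : (1:ℝ) ≤ (1 + ‖y‖) ^ K := one_le_pow₀ (le_add_of_nonneg_right (norm_nonneg _))
    nlinarith [abs_nonneg (g y - g' y)]
  have hD' : ∀ y : E × E, (1 + ‖y‖) ^ (Module.finrank ℝ E + 1) * |g y - g' y| ≤ D := fun y =>
    le_trans (mul_le_mul_of_nonneg_right (pow_le_pow_right₀ (le_add_of_nonneg_right (norm_nonneg _)) hK)
      (abs_nonneg _)) (hD y)
  have hN := abs_normFactor_sub_le hδ hg hg0 hC hg' hg'0 hC' hD' z
  have hLo := abs_loss_sub_le h hg hC hg' hC' hDu z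
  have hLo' : |loss B g' z| ≤ kernelMass B * Mb := by
    rw [abs_of_nonneg (loss_nonneg h hg'0 z)]; exact loss_le h hg'.continuous hM' z
  have hsplit : absorption δ B g z - absorption δ B g' z =
      normFactor δ g z * (loss B g z - loss B g' z) + (normFactor δ g z - normFactor δ g' z) * loss B g' z := by
    simp only [absorption]; ring
  rw [hsplit]
  calc |normFactor δ g z * (loss B g z - loss B g' z) + (normFactor δ g z - normFactor δ g' z) * loss B g' z|
      ≤ 1 * |loss B g z - loss B g' z| + |normFactor δ g z - normFactor δ g' z| * |loss B g' z| := by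
        refine (abs_add_le _ _).trans (add_le_add ?_ (le_of_eq (abs_mul _ _)))
        rw [abs_mul, abs_of_pos hNp]
        exact mul_le_mul_of_nonneg_right hNle (abs_nonneg _)
    _ ≤ kernelMass B * D + δ * ((∫ w : E, (1 + ‖w‖) ^ (-((Module.finrank ℝ E : ℝ) + 1))) * D) * (kernelMass B * Mb) := by
        rw [one_mul]
        exact add_le_add hLo (mul_le_mul hN hLo' (abs_nonneg _) (le_trans (abs_nonneg _) hN))
    _ = _ := by ring

/-! ## Continuity in a parameter -/

omit [FiniteDimensional ℝ E] [MeasurableSpace E] [BorelSpace E] in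
/-- Decay in the velocity variable from a weighted sup bound. [folklore] -/
theorem abs_le_weight_inv {k : E × E → ℝ} {Mb : ℝ}
    (hMb : ∀ y : E × E, (1 + ‖y‖) ^ (Module.finrank ℝ E + 1) * |k y| ≤ Mb) (x w : E) :
    |k (x, w)| ≤ Mb * (1 + ‖w‖) ^ (-((Module.finrank ℝ E : ℝ) + 1)) := by
  have := abs_sub_le_weight_inv (g := k) (g' := fun _ => 0) (D := Mb) (fun y => by simpa using hMb y) x w
  simpa using this

/-- **Continuity of the functionals in a parameter** (dominated convergence): for a family of
nonnegative continuous slices `g_s`, `s ∈ S`, continuous in `s` pointwise within `S` at `s₀`,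
with `|g_s| ≤ Mb` and `(1 + ‖y‖)^{d+1} |g_s(y)| ≤ Mb` uniformly, the local mass, the loss
frequency, the gain term, the absorption and the source of `g_s` at a fixed `z` are continuous in
`s` within `S` at `s₀`. [folklore] -/
theorem continuousWithinAt_functionals (h : KernelHyp B M R) (hδ : 0 ≤ δ) {gf : ℝ → E × E → ℝ}
    {S : Set ℝ} {s₀ : ℝ} (hs₀ : s₀ ∈ S) (hcont : ∀ s ∈ S, Continuous (gf s))
    (hnn : ∀ s ∈ S, ∀ y, 0 ≤ gf s y) {Mb : ℝ} (hMb : ∀ s ∈ S, ∀ y, |gf s y| ≤ Mb)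
    (hMbw : ∀ s ∈ S, ∀ y : E × E, (1 + ‖y‖) ^ (Module.finrank ℝ E + 1) * |gf s y| ≤ Mb)
    (hpt : ∀ y, ContinuousWithinAt (fun s => gf s y) S s₀) (z : E × E) :
    ContinuousWithinAt (fun s => mass (gf s) z) S s₀ ∧
    ContinuousWithinAt (fun s => loss B (gf s) z) S s₀ ∧
    ContinuousWithinAt (fun s => gain B (gf s) z) S s₀ ∧
    ContinuousWithinAt (fun s => absorption δ B (gf s) z) S s₀ ∧
    ContinuousWithinAt (fun s => source δ B (gf s) z) S s₀ := by
  have hMb0 : 0 ≤ Mb := (abs_nonneg _).trans (hMb s₀ hs₀ 0)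
  have hev : ∀ᶠ s in 𝓝[S] s₀, s ∈ S := self_mem_nhdsWithin
  -- mass
  have hmass : ContinuousWithinAt (fun s => mass (gf s) z) S s₀ := by
    refine continuousWithinAt_of_dominated (bound := fun w => Mb * (1 + ‖w‖) ^ (-((Module.finrank ℝ E : ℝ) + 1)))
      (hev.mono fun s hs => ((hcont s hs).comp (continuous_const.prodMk continuous_id)).aestronglyMeasurable)
      (hev.mono fun s hs => Eventually.of_forall fun w => ?_) (integrable_weight_inv.const_mul Mb)
      (Eventually.of_forall fun w => hpt (z.1, w))
    rw [Real.norm_eq_abs]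
    exact abs_le_weight_inv (hMbw s hs) z.1 w
  -- loss
  have hloss : ContinuousWithinAt (fun s => loss B (gf s) z) S s₀ := by
    refine continuousWithinAt_of_dominated (bound := fun q => B (q.1, 0) q.2 * Mb)
      (hev.mono fun s hs => (h.measurable_kernel.aestronglyMeasurable.mul
        (((hcont s hs).comp (continuous_const.add continuous_shiftLoss)).aestronglyMeasurable)))
      (hev.mono fun s hs => Eventually.of_forall fun q => ?_) (h.integrable.mul_const Mb)
      (Eventually.of_forall fun q => (hpt (z + shiftLoss q)).const_mul _)
    rw [norm_mul, Real.norm_of_nonneg (h.nonneg _ _), Real.norm_eq_abs]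
    exact mul_le_mul_of_nonneg_left (hMb s hs _) (h.nonneg _ _)
  -- gain
  have hgain : ContinuousWithinAt (fun s => gain B (gf s) z) S s₀ := by
    refine continuousWithinAt_of_dominated (bound := fun q => B (q.1, 0) q.2 * (Mb * Mb))
      (hev.mono fun s hs => (h.measurable_kernel.aestronglyMeasurable.mul
        ((((hcont s hs).comp (continuous_const.add continuous_shift₁)).mul
          ((hcont s hs).comp (continuous_const.add continuous_shift₂))).aestronglyMeasurable)))
      (hev.mono fun s hs => Eventually.of_forall fun q => ?_) (h.integrable.mul_const _)
      (Eventually.of_forall fun q => ((hpt (z + shift₁ q)).mul (hpt (z + shift₂ q))).const_mul _)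
    rw [norm_mul, Real.norm_of_nonneg (h.nonneg _ _), Real.norm_eq_abs, abs_mul]
    exact mul_le_mul_of_nonneg_left (mul_le_mul (hMb s hs _) (hMb s hs _) (abs_nonneg _) hMb0) (h.nonneg _ _)
  -- the normalising factor
  have hnf : ContinuousWithinAt (fun s => normFactor δ (gf s) z) S s₀ := by
    simp only [normFactor]
    refine (continuousWithinAt_const.add (hmass.const_mul δ) |>.congr (fun s _ => rfl) rfl).inv₀ ?_
    have := mass_nonneg (hnn s₀ hs₀) z
    show (1 : ℝ) + δ * mass (gf s₀) z ≠ 0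
    nlinarith
  exact ⟨hmass, hloss, hgain, hnf.mul hloss, hnf.mul hgain⟩

/-! ## Identification with the truncated collision operator -/

omit [FiniteDimensional ℝ E] [MeasurableSpace E] [BorelSpace E] in
/-- The shifted points as pairs: `z + shift₁ q = (x, v')`, `z + shift₂ q = (x, w')`,
`z + shiftLoss q = (x, v - u)`. [folklore] -/
theorem add_shift_eq_pair (z : E × E) (q : E × sphere (0 : E) 1) :
    z + shift₁ q = (z.1, (collide q.2 (z.2, z.2 - q.1)).1) ∧
      z + shift₂ q = (z.1, (collide q.2 (z.2, z.2 - q.1)).2) ∧ z + shiftLoss q = (z.1, z.2 - q.1) := by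
  obtain ⟨h1, h2, h3, h4⟩ := add_shift_eq_collide z q
  refine ⟨Prod.ext h3 h1, Prod.ext h4 h2, Prod.ext (by simp [shiftLoss]) (by simp [shiftLoss, sub_eq_add_neg])⟩

/-- The substitution `v_* = v - u` on `E × S^{d-1}` preserves the kernel measure. [folklore] -/
theorem integral_comp_sub_left_kernelMeasure (F : E × sphere (0 : E) 1 → ℝ) (v : E) :
    ∫ q, F (v - q.1, q.2) ∂(kernelMeasure E) = ∫ q, F q ∂(kernelMeasure E) := by
  haveI := isFiniteMeasure_sphereMeasure (E := E)
  have hmp : MeasurePreserving (Prod.map (fun u : E => v - u) (id : sphere (0 : E) 1 → sphere (0 : E) 1))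
      (kernelMeasure E) (kernelMeasure E) :=
    (Measure.measurePreserving_sub_left (volume : Measure E) v).prod (MeasurePreserving.id _)
  have hme : MeasurableEmbedding (Prod.map (fun u : E => v - u) (id : sphere (0 : E) 1 → sphere (0 : E) 1)) :=
    (measurableEmbedding_subLeft v).prodMap MeasurableEmbedding.id
  exact hmp.integral_comp hme F

/-- **Identification with the truncated collision operator of the scheme.** For a DiPerna–Lions
kernel satisfying `KernelHyp` (bounded, compactly supported, Galilean invariant) and a nonnegative
Schwartz-type slice `g`, the truncated, normalised collision operator of
`DiPernaLionsStability` applied to the velocity section `g(x, ·)` is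
`truncatedCollisionOp δ B (g(x, ·)) v = source δ B g (x, v) - absorption δ B g (x, v) g(x, v)`
(CIP 1994 (3.16): `Q̃ = (1 + δ∫g)⁻¹ (Q⁺ - Q⁻)`, `Q⁻(g,g) = g (A ∗ g)`; the substitution
`v_* = v - u`). [cite: CIPDiluteGases1994, §5.3 (3.16)] -/
theorem truncatedCollisionOp_eq (hBk : KineticTheory.IsDiPernaLionsKernel B) (h : KernelHyp B M R)
    (hg : ContDiff ℝ ∞ g) (hg0 : ∀ z, 0 ≤ g z)
    (hC : ∀ (n k : ℕ) (z : E × E), (1 + ‖z‖) ^ k * ‖iteratedFDeriv ℝ n g z‖ ≤ C n k) (δ : ℝ) (x v : E) :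
    truncatedCollisionOp δ B (fun w => g (x, w)) v =
      source δ B g (x, v) - absorption δ B g (x, v) * g (x, v) := by
  haveI := isFiniteMeasure_sphereMeasure (E := E)
  set gx : E → ℝ := fun w => g (x, w) with hgx
  have hgxc : Continuous gx := hg.continuous.comp (continuous_const.prodMk continuous_id)
  have hgx0 : ∀ w, 0 ≤ gx w := fun w => hg0 _
  have hgxb : ∀ w, |gx w| ≤ C 0 0 := fun w => abs_le_of_bounds hC _
  have hgxi : Integrable gx := integrable_mass_integrand hg hC x
  have hBb : ∀ p om, B p om ≤ M := fun p om => by rw [h.apply_eq p.1 p.2]; exact h.le _ _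
  obtain ⟨hgi, hli⟩ := gain_loss_integrable_of_bounded_kernel hBk hBb h.eq_zero hgxc hgxb hgxi v
  -- the normalising factor
  have hmass : ∫ w, |gx w| = mass g (x, v) := by
    rw [mass]
    exact integral_congr_ae (Eventually.of_forall fun w => abs_of_nonneg (hgx0 w))
  -- the gain term
  have hgain : gainWith B gx gx v = gain B g (x, v) := by
    rw [gainWith, ← integral_prod _ hgi, gain, ← integral_comp_sub_left_kernelMeasure _ v]
    refine integral_congr_ae (Eventually.of_forall fun q => ?_)
    obtain ⟨h1, h2, -⟩ := add_shift_eq_pair ((x, v) : E × E) q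
    simp only [hgx, h1, h2]
    rw [h.apply_eq v (v - q.1), sub_sub_cancel]
  -- the loss term
  have hloss : lossWith B gx gx v = gx v * loss B g (x, v) := by
    rw [lossWith, ← integral_prod _ hli, loss, ← integral_const_mul, ← integral_comp_sub_left_kernelMeasure _ v]
    refine integral_congr_ae (Eventually.of_forall fun q => ?_)
    obtain ⟨-, -, h3⟩ := add_shift_eq_pair ((x, v) : E × E) q
    simp only [hgx, h3]
    rw [h.apply_eq v (v - q.1), sub_sub_cancel]
    ring
  rw [truncatedCollisionOp, collisionOpWith_eq_gainWith_sub_lossWith_holds B gx gx v hgi hli, hmass, hgain, hloss,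
    source, absorption, normFactor]
  simp only [hgx]
  ring

end TruncPicard

end Literature.MathematicalPhysics.KineticTheory
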